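import Summits.CriticalPhenomena.PercolationContinuityZ3.Theorems.Transplant.SkelPhiNegReachInputsB
import Summits.CriticalPhenomena.PercolationContinuityZ3.Theorems.Transplant.SkelPhiNegReachFloors
import HarnessLib

/-!
# N1 (the `{±1}` node), (C) column file (C-S11): THE (C) RESIDUE FROM FIVE PRIMITIVE FLOORS — **`Skelφ.reachOblRHN_negSG₂b_of_floors`**:
# `Skel.ReachOblRHN` (step budget `2000 = nmaxN`) for the twin scheme ⟨cellGeomSG₂b … b₀, q, δc⟩ with the corridor records AT THE VALUES OF RECORD
# `Skelφ.CorrRec.*` (RULING B.15 S1 + B.16: v-rounds `vLocPrmD n ℓ h v_α T W_A L0_A N_A`, u-rounds `xLocPrm n ℓ h T W_B L0_B N_B`, windowed band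
# `bandNw …`, habitat points `CorrRec.zB`, `Zmax := 800·(n + W_B)`), every join, room, target and habitat-point hypothesis of
# `reachOblRHN_negSG₂b_of_inputs` (C-S7b) DISCHARGED (C-S8, C-S9b, C-S9g, C-S10); what remains: the fine-map data and its commensurate resolutions
# (`c_i'·A·40Δ = r_i·D`), the lattice range `nℓ − n < Δ ≤ nℓ`, the frame change of the arrival box (`ha`, `hBx`, `hb'` at `aW, Bx, bL`), the five
# primitive floors (P1) `2000(T+2) ≤ n`, (P2) `2000(T+2)·U ≤ nℓ − n`, (P3) `W_A ≤ 24n`, (P4) `U(L0_A + 1) ≤ 12Δ`, (P5) `r_i ≤ 4·b₀_i`, `b₀ ≤ 2r`,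
# the habitat-point depth `dC + (kq+3)·800(n + W_B) + 3 ≤ E₀`, the kit block (slack `T = e_A`: `Rlev + 1 ≤ T`, `j₁ + reach ≤ T`), the schedule /
# excess data and the Step-I″ inputs at every centre.

builds on p205010 (kernel theorem, internal audit signed; external expert review pending) — nothing in this file uses p205010; nothing here is a
claim about the open node `SamePDropOfSkeletonNeg`.
Lane `prim-bschramm`, seat `prim-bschramm-p5` (gen 9; (C) lineage); helper file (`--supports stmt-CriticalPhenomena-4575`).
[cite: KozmaNitzan2024, §4 Lemma 10 Steps III–V (pp. 19–22), Lemma 11 (pp. 22–23), Lemma 12 (pp. 23–25), p. 30 (Step IV), p. 31] [cite: MartineauTassion2017, §4.3 Lemma 4.2]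
-/

noncomputable section

open MeasureTheory

namespace Summit.CriticalPhenomena.PercolationContinuityZ3.Theorems

namespace Transplant

namespace Skelφ

open Literature.Probability.Percolation Literature.Probability.LatticeModels SimpleGraph GadgetSystem ProbeHistory HSiteScheme Contour KNCells
open KNCells.KSchA KNLevels ChainPlanar ChainPara
open Literature.Probability.Percolation.GM
open Literature.Probability.Percolation.KozmaNitzan.Cells (oth sgOf sgOf_sign stepVec_apply_fst stepVec_apply_oth)
open Literature.Barriers.CriticalPhenomena (graphBall graphBall_finite mem_graphBall_self graphBall_mono)
open BoxProdZ2 (ConcRadiiG nQ nS Erad Frad Erad_mono Frad_succ Frad_le_Erad Erad_add_gap_le_Frad_succ add_mul_le_Erad)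
open TwoAxis.Para (modulus)
open Skel (excess winGraph winGraphIn winGraphIn_le ReachOblAtHN ReachOblRHN l1_tgt_le_nQ isSubbox_Wcor_hab)
open SkelI (tanOff)

open scoped Classical

variable {V : Type} [DecidableEq V] {G : SimpleGraph V} [G.LocallyFinite] {φ : V → Site 2}

/-! ## The residue from the floors -/

/-- **`Skel.ReachOblRHN` FOR THE TWIN SCHEME OF RECORD FROM THE PRIMITIVE FLOORS AND THE INPUTS AT EVERY CENTRE** (see the module
docstring). [cite: KozmaNitzan2024, §4 Lemmas 10–12 (pp. 17–25), p. 30 (Step IV), p. 31] -/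
theorem reachOblRHN_negSG₂b_of_floors [Countable V] {types : Finset V} (hfr : Frames G φ types) (hκc : CylConn G φ types)
    {Δ : ℕ} (hΔ : ∀ v, G.degree v ≤ Δ) (hstep : Steps G φ) (hlipφ : Lip G φ) {t : V} {A : ℤ} (hA : 0 < A) {n : ℕ} (hn : 1 ≤ n)
    {h vα vβ : ℤ} (hm : 0 < modulus n h vα vβ) {c₀' c₁' s₀ s₁ D : ℤ} (hc₀' : 0 < c₀') (hc₁' : 0 < c₁') (hD : 0 < D)
    {kq : ℕ} (hκ : h.natAbs ≤ kq * n)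
    (F : V → Site 2) (hFdef : F = fineSkel φ t A n h vα vβ c₀' c₁' s₀ s₁ D) (hlipF : Lip G F) (hws : WeakSteps G F) (hF0 : F t = 0)
    (P : PCells2) (gap gap' : ℕ → ℕ) (E₀ L' : ℕ) (off : Site 2 → ℕ) (q : unitInterval) (δc : ℝ) (b₀ : Fin 2 → ℕ) (hb : ∀ i, b₀ i ≤ 3 * P.r i)
    (hΛ : WFS2 P (concRadii2N P gap gap' E₀ L' off)) (hgap : ∀ m, 20 * P.rmax ≤ gap m) {c : ℕ} (hgapc : ∀ m, c ≤ gap m)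
    (hoff : ∀ x : Site 2, off x ≤ c * ((x 0).natAbs + (x 1).natAbs) + 1) (hE₀ : 3 ≤ E₀) (hgapL : ∀ ρ, L' ≤ gap ρ)
    (hcol : ∀ a x, ∃ y ∈ VWin G F t (P.Q x) ((concRadii2N P gap gap' E₀ L' off).rQ a x), F y = P.cen x)
    -- the column vertices (bases of the run frames)
    (cOf : ℕ → Site 2 → V) (hcF : ∀ a y, F (cOf a y) = P.cen y)
    (hcQ : ∀ a y, cOf a y ∈ VWin G F t (P.Q y) ((concRadii2N P gap gap' E₀ L' off).rQ a y))
    {cC dC : ℕ} (hcD : ∀ a (y : Site 2), cOf a y ∈ graphBall G t (cC * ((y 0).natAbs + (y 1).natAbs) + dC)) (hgapC : ∀ m, cC ≤ gap m)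
    -- the long data of the strides and the concrete corridor records
    {ℓ : ℕ} (hvn : |vα| ≤ n) (hlay : 2 * ((n + h.natAbs : ℕ) : ℤ) ≤ (n : ℤ) * ℓ + 1) (T : ℕ)
    -- segment A: the arrival box `cen ± b₀` read into the v-rounds' start box
    {aW Bx bL : ℤ}
    (ha : D * (c₁' * (n : ℤ) * ((b₀ 0 : ℕ) + 1) + c₀' * |vα| * ((b₀ 1 : ℕ) + 1)) ≤ c₀' * c₁' * A * modulus n h vα vβ * aW)
    (hBx : D * (((b₀ 1 : ℕ) : ℤ) + 1) ≤ c₁' * A * Bx) (hb' : Bx / (shearUnit n h : ℤ) + 1 ≤ bL)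
    -- the range of the lattice determinant, the commensurate resolutions, the five primitive floors (RULING B.16: `r_i ≤ 4·b₀_i`)
    (hΔlo : (n : ℤ) * ℓ - n < modulus n h vα vβ) (hΔhi : modulus n h vα vβ ≤ (n : ℤ) * ℓ)
    (hsc0 : c₀' * A * (40 * modulus n h vα vβ) = (P.r 0 : ℤ) * D) (hsc1 : c₁' * A * (40 * modulus n h vα vβ) = (P.r 1 : ℤ) * D)
    (P1 : 2000 * (T + 2) ≤ n) (P2 : 2000 * ((T : ℤ) + 2) * (shearUnit n h : ℤ) ≤ (n : ℤ) * ℓ - n)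
    (P3 : ((CorrRec.WA n aW : ℕ) : ℤ) ≤ 24 * n) (P4 : (shearUnit n h : ℤ) * (((CorrRec.L0A bL : ℕ) : ℤ) + 1) ≤ 12 * modulus n h vα vβ)
    (P5 : ∀ i, P.r i ≤ 4 * b₀ i)
    (hbr : ∀ i, ((b₀ i : ℕ) : ℤ) ≤ 2 * (P.r i : ℤ))
    (hE₀Z : dC + (kq + 3) * (800 * (n + CorrRec.Qw n ℓ h)) + 3 ≤ E₀)
    -- kit constants, count, excess radius
    {Rlev Nk j₀ j₁ : ℕ} (hRl : Rlev + 1 ≤ T) (hj : j₁ ≤ Rlev)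
    {δ η : ℝ} (hcount : 1 / (1 - (q : ℝ)) ^ (Δ * Nk) ≤ δ * ((Finset.Icc j₀ j₁).card : ℝ)) (hη : η ≤ δ / 2)
    {Rex : ℕ → ℕ}
    (hRex : ∀ R₀' R₁, Rex R₀' ≤ R₁ → ∀ (Rw : ℕ) (D' A' : Finset V), (∀ d ∈ D', d ∈ graphBall G t Rw) →
      (∀ d ∈ D', ∀ d' ∈ D', F d - F d' ∈ box 2 (50 * P.rmax)) → A' ⊆ D' → (∀ a ∈ A', a ∈ graphBall G t R₀') →
        (bondPercolation G q).real (excess G t R₁ D' A') ≤ η)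
    (hsch : ∀ g, Rex (Erad gap gap' E₀ g + 1) + L' ≤ Erad gap gap' E₀ (g + 1))
    -- the kit block
    (Pk : ApronPrm) {Rs Kmax KCmax rs cS cU Mz kz : ℕ} (hPN : kq + 3 ≤ Pk.N) (hAk : Pk.A = (Mz + 1 : ℕ) * (shearUnit n h : ℤ) + 1)
    (hd1 : Pk.W + Pk.ℓ ≤ Pk.d) (hD1 : Pk.W + Pk.ℓ + Pk.d + 2 ≤ shellD Pk) (hD2 : Pk.ℓ + Rs + Pk.d + 3 ≤ shellD Pk) (hDρ : Rs + 1 ≤ shellD Pk)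
    (hℓk : 1 ≤ Pk.ℓ) (hWk : Rs + Pk.ℓ ≤ Pk.W) (hKmax : (shellD Pk + Pk.W) * (kq + 1) ≤ Kmax) (hKCmax : (shellD Pk + Mz + 1) * (kq + 1) ≤ KCmax)
    (hR'k : cylRadMax G φ types Pk.ℓ (Rs + KCmax + (Pk.W + Kmax)) ≤ Pk.R')
    (hT : (Pk.W : ℤ) + Kmax + Pk.ℓ + 1 ≤ tanOff Pk.ℓs Pk.M) (hT' : (shellD Pk : ℤ) + KCmax + Rs ≤ tanOff Pk.ℓs Pk.M)
    (hr₀ : Pk.N * (tanOff Pk.ℓs Pk.M + 2) + Pk.N * Pk.d + (Pk.W + Kmax + Pk.R') + (KCmax + Rs) ≤ Pk.r₀)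
    (hrs : 2 * (1 + Pk.N * (tanOff Pk.ℓs Pk.M + 2) + Pk.N * Pk.d + (Pk.W + Kmax + Pk.R') + (KCmax + Rs)) ≤ rs)
    (hcS : (Pk.N + 1) * (tanOff Pk.ℓs Pk.M + 1) + (Pk.N + 1) * Pk.d + (2 * Pk.W + 1) * (Kmax + 1) * (Δ + 1) ^ Pk.R' ≤ cS)
    (hj₀T : tanOff Pk.ℓs Pk.M ≤ j₀) (hjreach : j₁ + (Pk.N * (tanOff Pk.ℓs Pk.M + 1) + Pk.N * Pk.d + KCmax) ≤ T)
    {Rl : ℕ} (hRlreach : Rl + (Pk.N * (tanOff Pk.ℓs Pk.M + 1) + Pk.N * Pk.d + KCmax) ≤ Pk.r₀)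
    (Rg : V → Finset V) (hRg : ∀ c, ∀ u ∈ Rg c, u ∈ graphBall G c Rs) (hRgcard : ∀ c, (Rg c).card ≤ cU) (hcU1 : 1 ≤ cU)
    (Λc : V → ℕ → Finset V) (hkn : ∀ c, Λc c kz ⊆ Λc c Mz) (hΛz : ∀ c, ∀ v ∈ Λc c Mz, v ∈ Rg c ∧ φ v - φ c ∈ box 2 Mz)
    (hZc : ∀ c, (↑(Λc c Mz) : Set V) ⊆ cyl φ c Mz) (hMz : Mz < n) (hclear : (Mz + 4) * (n + h.natAbs) ≤ n * (ℓ + 1))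
    (Pex : Fin 2 → ℤˣ → V → Finset V)
    (hPex : ∀ (cb : V) (Lo Hi : Site 2) (i : Fin 2) (σ₀ : ℤˣ) (c : V), ∀ v ∈ Pex i σ₀ c, v ∈ Rg c ∧
      (runXSideU (φ := φ) cb hn h (Or.inl rfl) Lo Hi i σ₀).lin (φ v) + Pk.A +
        ((runXSideU (φ := φ) cb hn h (Or.inl rfl) Lo Hi i σ₀).s : ℤ) *
          coef (runXSideU (φ := φ) cb hn h (Or.inl rfl) Lo Hi i σ₀).cα (runXSideU (φ := φ) cb hn h (Or.inl rfl) Lo Hi i σ₀).cβ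
            (runXSideU (φ := φ) cb hn h (Or.inl rfl) Lo Hi i σ₀).a ≤
      (runXSideU (φ := φ) cb hn h (Or.inl rfl) Lo Hi i σ₀).lin (φ c))
    (kk : ℕ) (hNk : kk * (Δ + 1) ^ (2 * rs) ≤ Nk) (hkδ : (1 - (q : ℝ) ^ (1 + Δ * cS + cS * cU)) ^ kk ≤ δ) (hδ : 0 < δ)
    -- the depth budget of the plain windows
    (hr₀L : Pk.r₀ + 3 ≤ L') (hL'E : L' ≤ E₀)
    -- THE INPUTS AT EVERY CENTRE: zone, exit links, long top pieces (both signs, split `vα`), long side halves (both signs)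
    (hzone : ∀ c, 1 - δ ^ 2 < (bondPercolation G q).real (UniqZone.zone G (Λc c) kz Mz))
    (hexit : ∀ c (i : Fin 2) (σ₀ : ℤˣ), 1 - δ ^ 2 < (bondPercolation G q).real (linkIn (↑(Rg c) : Set V) (Λc c kz) (Pex i σ₀ c)))
    (hlongT : ∀ c (σ τ : ℤ), σ = 1 ∨ σ = -1 → τ = 1 ∨ τ = -1 → 1 - δ ^ 2 < (bondPercolation G q).real
      (linkIn (pgramPrism G φ c n h (3 * ℓ) Rl) (Λc c kz) (pgTopPieceW G φ c n h ℓ Rl σ τ vα)))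
    (hlongS : ∀ c (σ τ : ℤ), σ = 1 ∨ σ = -1 → τ = 1 ∨ τ = -1 → 1 - δ ^ 2 < (bondPercolation G q).real
      (linkIn (pgramPrism G φ c n h (3 * ℓ) Rl) (Λc c kz) (pgSideHalfW G φ c n h ℓ Rl σ (σ * τ)))) :
    ReachOblRHN G 2000 (⟨cellGeomSG₂b G F P t (concRadii2N P gap gap' E₀ L' off) b₀, q, δc⟩ : KSchA V ℕ)
      (faceDataSG G F P t (concRadii2N P gap gap' E₀ L' off)) Δ δ := by
  obtain ⟨hS1A, hS0A, hS1B, hS0B, hsT, hT1, hNN, heA, heAn⟩ := CorrRec.floors_rounds (vβ := vβ) (aW := aW) (bL := bL) hn hvn hΔlo hΔhi P1 P2 P3 P4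
  obtain ⟨hbx1, hbx2, hbx3, hby1, hby2, hby3⟩ := CorrRec.floors_band (P := P) (aW := aW) (bL := bL) hn hvn hΔlo hΔhi P1 P2 P3 P4
  obtain ⟨hxL1, hxL3, hyL1, hyL2, hyL3⟩ := CorrRec.floors_target (P := P) (b₀ := b₀) (aW := aW) (bL := bL) hn hvn hΔlo hΔhi P1 P2 P3 P4 P5
  have hWn := CorrRec.n_le_WA n aW
  have hWB : n * ℓ / shearUnit n h + 1 ≤ CorrRec.Qw n ℓ h := le_rfl
  have hWx := CorrRec.Qw_le_qy n ℓ h vα T aW bL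
  have hWmy := CorrRec.Wmy_ge n vα
  have hWpy := CorrRec.Wpy_ge n vα
  have hPA : LocOKD (vLocPrmD n ℓ h vα T (CorrRec.WA n aW) (CorrRec.L0A bL) (CorrRec.NA n ℓ h T bL)) := vLocPrmD_ok hn hvn hWn heA _ _
  have hPB : LocOK (xLocPrm n ℓ h T (CorrRec.Qw n ℓ h) (CorrRec.L0B n ℓ h vα T aW bL) (CorrRec.NB n ℓ h vα T aW bL)) := xLocPrm_ok heAn hWB _ _
  exact reachOblRHN_negSG₂b_of_inputs hfr hκc hΔ hstep hlipφ hA hn hm hc₀' hc₁' hD hκ F hFdef hlipF hws hF0 P gap gap' E₀ L' off q δc b₀ hb hΛ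
    hgap hgapc hoff hE₀ hgapL hcol cOf hcF hcQ hcD hgapC hvn hlay hWn heA heAn hWB hWx hWmy hWpy ha hBx hb'
    (CorrRec.aW_le_WA n aW) (CorrRec.bL_le_L0A bL)
    (CorrRec.hjoin (hn := hn) (hvn := hvn) (hlay := hlay) (heAn := heAn) (hWB := hWB) (hWx := hWx) (hWmy := hWmy) (hWpy := hWpy) hT1)
    (CorrRec.hreg (hn := hn) (hvn := hvn) (hlay := hlay) (heAn := heAn) (hWB := hWB) (hWx := hWx) (hWmy := hWmy) (hWpy := hWpy))
    (CorrRec.hjoinA (hn := hn) (hvn := hvn) (hWn := hWn) (heA := heA) (heAn := heAn) (hWB := hWB) hsT)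
    (CorrRec.hrdA0 hn hA hD hm hc₀' hsc0 hsc1 hPA hS1A hS0A) (CorrRec.hrdB0 hn hA hD hm hc₀' hsc0 hsc1 hPB hS1B hS0B)
    (CorrRec.hrdC0 hn hA hD hm hc₀' hsc0 hsc1 hΔlo hΔhi hsT hbx1 hbx2 hbx3 hby1 hby2 hby3)
    (CorrRec.hrdLC hn hA hD hm hc₀' hsc0 hsc1 hΔlo hΔhi b₀ hxL1 hxL3 hyL1 hyL2 hyL3) hbr
    (CorrRec.zB n ℓ h vα) (CorrRec.zB_mem hn) (CorrRec.zB_l1 hvn)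
    (CorrRec.hrdZC hn hA hD hm hc₀' hsc0 hsc1 hΔlo hΔhi hbx1 hbx2 hbx3 hby1 hby2 hby3) hE₀Z (CorrRec.hlen hNN)
    hRl hj hcount hη hRex hsch Pk hPN hAk hd1 hD1 hD2 hDρ hℓk hWk hKmax hKCmax hR'k hT hT' hr₀ hrs hcS hj₀T hjreach hRlreach Rg hRg hRgcard hcU1
    Λc hkn hΛz hZc hMz hclear Pex hPex kk hNk hkδ hδ hr₀L hL'E
    (CorrRec.hrdA1 hn hA hD hm hc₀' hsc0 hsc1 hPA hS1A hS0A) (CorrRec.hrdB1 hn hA hD hm hc₀' hsc0 hsc1 hPB hS1B hS0B)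
    (CorrRec.hrdC1 hn hA hD hm hc₀' hsc0 hsc1 hΔlo hΔhi hsT hbx1 hbx2 hbx3 hby1 hby2 hby3) hzone hexit hlongT hlongS

end Skelφ

end Transplant

end Summit.CriticalPhenomena.PercolationContinuityZ3.Theorems

end
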